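import Mathlib
import Literature.Analysis.FluidPDE.VectorCalculus
import Literature.Analysis.FluidPDE.LeiZhang2011Proofs
import Summits.NavierStokesRegularity.NavierStokesRegularity.Theorems.FilamentSkeletonRssSelectionBoxRJRungNearStraightTail
import Summits.NavierStokesRegularity.NavierStokesRegularity.Theorems.FilamentSkeletonRssSelectionBoxRJRungPartnerStrain

/-!
# Route `FilamentSkeletonRss` · crux `SelectionBoxRJ` (stmt-NavierStokesRegularity-21220) — rung tools:
# the axial SELF-strain of a near-straight `C^{2,1}` filament is small (explicit, `e`-uniform)

Lane `ns-filament-19175-p1` (g6); closes the gap «dR/dt» of the memo `SIGMA-SCALING-21220.md` §5/§7 for what clause 11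
actually needs.  Helper file `--supports stmt-NavierStokesRegularity-21220`; route-independent.

By the stretching identity (`strain_identity`, `box_slip_deriv`) the tangential speed of a box filament obeys
`w_j′ = ½ + ⟪X_j′, D(u_X)(X_j) X_j′⟫`, and `u_X = Σ_k (Γγ_k/4π) F_k` is a sum of regularised Biot–Savart FIELDS.  The
partner terms `k ≠ j` are bounded by `…RungPartnerStrain` (`1/D²` decay).  This file bounds the SELF term `k = j`:
with `F` the field of the filament `X` itself, `T = X′(t)`,
`⟪T, DF(X t) T⟫ = ∫ −3⟪X t − X u, T⟫ K₅ ⟪T, X′(u) × (X t − X u)⟫ du` — the `K₃`-part of the derivative integrand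
(`biotSavart_fderiv_apply_eq`) drops out EXACTLY (`⟪T, X′(u) × T⟫ = 0`), and the triple product
`⟪T, X′(u) × (X t − X u)⟫` vanishes to fourth order at `u = t`:

* `inner_cross_tangent_chord_le` — with the `C^{2,1}` Taylor data of the LIA bricks (`‖a − T − sN‖ ≤ Hs²`,
  `‖z − sT − (s²/2)N‖ ≤ H|s|³`, `‖N‖ ≤ κ₀`, `‖T‖ = 1`): `|⟪T, a × z⟫| ≤ (3/2)κ₀H s⁴ + H²|s|⁵`.
* `selfStrain_integrand_window_le` — hence, with chord-arc `c|s| ≤ ‖z‖`, the integrand is bounded on the window by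
  `(3/c⁴)((3/2)κ₀H + H²|s|)` (no `log`, no `1/e`: the singular part is absent, not merely cancelled).
* `selfStrain_integrand_tail_le` — on the tail, for a near-straight curve (`‖X′ − a₀‖ ≤ θ`, `‖a₀‖ ≤ 1`), the
  integrand is `≤ (6θ/c⁴)|u − t|⁻³` (`norm_cross_chord_le_of_nearStraight`).
* `self_axialStrain_le` — assembling: `|⟪X′ t, DF(X t) X′ t⟫| ≤ 6θ/(c⁴δ²) + 2δ·(3/c⁴)((3/2)κ₀H + H²δ)` for every
  window `δ > 0`.  In the box scaling (`θ = O(Rb²)`, `κ₀, H = O(1/log Γ)` in waist units, `c ≥ 1 − θ`) the axial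
  self-strain is `O(Rb² + 1/log Γ)`: together with the partner bound and `box_slip_zero_unique` this is the true-box
  form of memo §4 (zeros of `w_j` confined to the zone where the partner strain reaches `½ − O(Rb² + 1/log Γ)`).

HONEST FRAMING.  Kernel estimates for the rung ladder of a HYPOTHETICAL filament box (the box's filaments are only `C²`;
the `C^{2,1}` modulus `H` is an extra hypothesis, as in the tree's LIA bricks); nothing here is a claim about
Navier–Stokes regularity or blow-up.
-/

set_option linter.dupNamespace false

noncomputable section

namespace Summit.NavierStokesRegularity.NavierStokesRegularity.Theorems

open Set Function Filter MeasureTheory Real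
open Literature.Analysis.FluidPDE
open Summit.NavierStokesRegularity.NavierStokesRegularity.Theorems.SkeletonEquilibrium.Sketch
open scoped InnerProductSpace Topology

namespace SelectionBoxRJRung

/-! ### Pointwise algebra -/

/-- **The triple product `⟪T, a × z⟫` vanishes to fourth order.**  For a unit `T`, `N` with `‖N‖ ≤ κ₀`, and vectors
`a, z` with `‖a − T − s N‖ ≤ H s²`, `‖z − s T − (s²/2) N‖ ≤ H|s|³` (`H ≥ 0`):
`|⟪T, a × z⟫| ≤ (3/2) κ₀ H s⁴ + H²|s|⁵`. [folklore] -/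
theorem inner_cross_tangent_chord_le {T N a z : EuclideanSpace ℝ (Fin 3)} {s H κ₀ : ℝ} (hT : ‖T‖ = 1)
    (hN : ‖N‖ ≤ κ₀) (hH : 0 ≤ H) (hr₁ : ‖a - T - s • N‖ ≤ H * s ^ 2)
    (hr₂ : ‖z - s • T - (s ^ 2 / 2) • N‖ ≤ H * |s| ^ 3) :
    |⟪T, cross a z⟫_ℝ| ≤ 3 / 2 * κ₀ * H * s ^ 4 + H ^ 2 * |s| ^ 5 := by
  have hκ : 0 ≤ κ₀ := (norm_nonneg _).trans hN
  -- triple products with a repeated `T` vanish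
  have hTTx : ∀ x : EuclideanSpace ℝ (Fin 3), ⟪T, cross T x⟫_ℝ = 0 := fun x => by
    simp [cross, crossProduct, PiLp.inner_apply, Fin.sum_univ_three]; ring
  have hTxT : ∀ x : EuclideanSpace ℝ (Fin 3), ⟪T, cross x T⟫_ℝ = 0 := fun x => by
    simp [cross, crossProduct, PiLp.inner_apply, Fin.sum_univ_three]; ring
  set r₁ := a - T - s • N with hr₁def
  set r₂ := z - s • T - (s ^ 2 / 2) • N with hr₂def
  -- reduce to `⟪T, (sN + r₁) × ((s²/2)N + r₂)⟫ = s ⟪T, N × r₂⟫ + ⟪T, r₁ × ((s²/2)N + r₂)⟫`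
  have hred : ⟪T, cross a z⟫_ℝ = s * ⟪T, cross N r₂⟫_ℝ + ⟪T, cross r₁ ((s ^ 2 / 2) • N + r₂)⟫_ℝ := by
    have hdec : cross a z = cross (a - T) (z - s • T) + s • cross a T + cross T z := by
      ext i; fin_cases i <;> simp [cross, crossProduct] <;> ring
    have haT : a - T = s • N + r₁ := by rw [hr₁def]; abel
    have hzT : z - s • T = (s ^ 2 / 2) • N + r₂ := by rw [hr₂def]; abel
    have hkey : cross (s • N + r₁) ((s ^ 2 / 2) • N + r₂) = s • cross N r₂ + cross r₁ ((s ^ 2 / 2) • N + r₂) := by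
      ext i; fin_cases i <;> simp [cross, crossProduct] <;> (try ring) <;> (try simp)
    rw [hdec, inner_add_right, inner_add_right, inner_smul_right, hTxT, hTTx, mul_zero, add_zero, add_zero, haT, hzT,
      hkey, inner_add_right, inner_smul_right]
  rw [hred]
  have hb1 : |⟪T, cross N r₂⟫_ℝ| ≤ κ₀ * (H * |s| ^ 3) := by
    calc |⟪T, cross N r₂⟫_ℝ| ≤ ‖T‖ * ‖cross N r₂‖ := abs_real_inner_le_norm _ _
      _ ≤ 1 * (‖N‖ * ‖r₂‖) := by rw [hT]; exact mul_le_mul_of_nonneg_left (norm_cross_le_norm_mul_norm _ _) zero_le_one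
      _ ≤ 1 * (κ₀ * (H * |s| ^ 3)) := by gcongr
      _ = κ₀ * (H * |s| ^ 3) := one_mul _
  have hb2 : |⟪T, cross r₁ ((s ^ 2 / 2) • N + r₂)⟫_ℝ| ≤ H * s ^ 2 * (s ^ 2 / 2 * κ₀ + H * |s| ^ 3) := by
    have hq : ‖(s ^ 2 / 2) • N + r₂‖ ≤ s ^ 2 / 2 * κ₀ + H * |s| ^ 3 := by
      calc ‖(s ^ 2 / 2) • N + r₂‖ ≤ ‖(s ^ 2 / 2) • N‖ + ‖r₂‖ := norm_add_le _ _
        _ ≤ s ^ 2 / 2 * κ₀ + H * |s| ^ 3 := by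
            rw [norm_smul, Real.norm_of_nonneg (by positivity : (0:ℝ) ≤ s ^ 2 / 2)]
            exact add_le_add (mul_le_mul_of_nonneg_left hN (by positivity)) hr₂
    calc |⟪T, cross r₁ ((s ^ 2 / 2) • N + r₂)⟫_ℝ| ≤ ‖T‖ * ‖cross r₁ ((s ^ 2 / 2) • N + r₂)‖ := abs_real_inner_le_norm _ _
      _ ≤ 1 * (‖r₁‖ * ‖(s ^ 2 / 2) • N + r₂‖) := by
          rw [hT]; exact mul_le_mul_of_nonneg_left (norm_cross_le_norm_mul_norm _ _) zero_le_one
      _ ≤ 1 * (H * s ^ 2 * (s ^ 2 / 2 * κ₀ + H * |s| ^ 3)) := by gcongr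
      _ = H * s ^ 2 * (s ^ 2 / 2 * κ₀ + H * |s| ^ 3) := one_mul _
  have hs2 : s ^ 2 = |s| ^ 2 := (sq_abs s).symm
  have hs4 : s ^ 4 = |s| ^ 4 := by rw [show (4:ℕ) = 2 * 2 by norm_num, pow_mul, hs2, ← pow_mul]
  calc |s * ⟪T, cross N r₂⟫_ℝ + ⟪T, cross r₁ ((s ^ 2 / 2) • N + r₂)⟫_ℝ|
      ≤ |s * ⟪T, cross N r₂⟫_ℝ| + |⟪T, cross r₁ ((s ^ 2 / 2) • N + r₂)⟫_ℝ| := abs_add_le _ _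
    _ = |s| * |⟪T, cross N r₂⟫_ℝ| + |⟪T, cross r₁ ((s ^ 2 / 2) • N + r₂)⟫_ℝ| := by rw [abs_mul]
    _ ≤ |s| * (κ₀ * (H * |s| ^ 3)) + H * s ^ 2 * (s ^ 2 / 2 * κ₀ + H * |s| ^ 3) :=
        add_le_add (mul_le_mul_of_nonneg_left hb1 (abs_nonneg s)) hb2
    _ = 3 / 2 * κ₀ * H * s ^ 4 + H ^ 2 * |s| ^ 5 := by rw [hs4, hs2]; ring

/-- **Window bound for the self-strain integrand.**  With the data of `inner_cross_tangent_chord_le`, `w = −z`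
(the chord `X t − X u`), chord-arc `c|s| ≤ ‖z‖` (`c > 0`):
`|−3⟪w, T⟫ K₅(w) ⟪T, a × w⟫| ≤ (3/c⁴)((3/2)κ₀H + H²|s|)` for every core `e`. [folklore] -/
theorem selfStrain_integrand_window_le (e : ℝ) {T N a z w : EuclideanSpace ℝ (Fin 3)} {s H κ₀ c : ℝ}
    (hT : ‖T‖ = 1) (hN : ‖N‖ ≤ κ₀) (hH : 0 ≤ H) (hc : 0 < c) (hr₁ : ‖a - T - s • N‖ ≤ H * s ^ 2)
    (hr₂ : ‖z - s • T - (s ^ 2 / 2) • N‖ ≤ H * |s| ^ 3) (hcz : c * |s| ≤ ‖z‖) (hw : w = -z) :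
    |(-3 * ⟪w, T⟫_ℝ * ((‖w‖ ^ 2 + e ^ 2) ^ (5 / 2 : ℝ))⁻¹) * ⟪T, cross a w⟫_ℝ| ≤
      3 / c ^ 4 * (3 / 2 * κ₀ * H + H ^ 2 * |s|) := by
  have hκ : 0 ≤ κ₀ := (norm_nonneg _).trans hN
  subst hw
  rcases eq_or_ne s 0 with hs | hs
  · -- at `s = 0` the chord vanishes: `z = r₂` with `‖r₂‖ ≤ 0`
    have hz : z = 0 := by
      have : ‖z - s • T - (s ^ 2 / 2) • N‖ ≤ 0 := by simpa [hs] using hr₂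
      have h0 : z - s • T - (s ^ 2 / 2) • N = 0 := norm_le_zero_iff.1 this
      simpa [hs] using h0
    have hR : 0 ≤ 3 / c ^ 4 * (3 / 2 * κ₀ * H + H ^ 2 * |s|) := by positivity
    simp [hz, hR]
  have hσ : 0 < |s| := abs_pos.2 hs
  have hzpos : 0 < ‖z‖ := lt_of_lt_of_le (mul_pos hc hσ) hcz
  have hdet : |⟪T, cross a (-z)⟫_ℝ| ≤ 3 / 2 * κ₀ * H * s ^ 4 + H ^ 2 * |s| ^ 5 := by
    have : cross a (-z) = -cross a z := map_neg (crossCLM a) z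
    rw [this, inner_neg_right, abs_neg]
    exact inner_cross_tangent_chord_le hT hN hH hr₁ hr₂
  obtain ⟨-, hK5⟩ := rosenhead_kernel_le_inv_pow hzpos e
  rw [norm_neg]
  have hinner : |⟪-z, T⟫_ℝ| ≤ ‖z‖ := by
    calc |⟪-z, T⟫_ℝ| ≤ ‖-z‖ * ‖T‖ := abs_real_inner_le_norm _ _
      _ = ‖z‖ := by rw [norm_neg, hT, mul_one]
  have hK5nn : 0 ≤ ((‖z‖ ^ 2 + e ^ 2) ^ (5 / 2 : ℝ))⁻¹ := inv_nonneg.2 (Real.rpow_nonneg (by positivity) _)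
  rw [abs_mul, abs_mul, abs_mul, abs_of_nonneg hK5nn, show |(-3:ℝ)| = 3 by norm_num]
  -- `3 ‖z‖ ‖z‖⁻⁵ (3/2 κ₀ H s⁴ + H² |s|⁵) ≤ 3 (c|s|)⁻⁴ (…)`
  have hz4 : (c * |s|) ^ 4 ≤ ‖z‖ ^ 4 := pow_le_pow_left₀ (by positivity) hcz 4
  have hcs : 0 < (c * |s|) ^ 4 := by positivity
  calc 3 * |⟪-z, T⟫_ℝ| * ((‖z‖ ^ 2 + e ^ 2) ^ (5 / 2 : ℝ))⁻¹ * |⟪T, cross a (-z)⟫_ℝ|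
      ≤ 3 * ‖z‖ * (‖z‖ ^ 5)⁻¹ * (3 / 2 * κ₀ * H * s ^ 4 + H ^ 2 * |s| ^ 5) := by
        gcongr
    _ = 3 * (‖z‖ ^ 4)⁻¹ * (3 / 2 * κ₀ * H * s ^ 4 + H ^ 2 * |s| ^ 5) := by
        field_simp
    _ ≤ 3 * ((c * |s|) ^ 4)⁻¹ * (3 / 2 * κ₀ * H * s ^ 4 + H ^ 2 * |s| ^ 5) :=
        mul_le_mul_of_nonneg_right (mul_le_mul_of_nonneg_left (inv_anti₀ hcs hz4) (by norm_num))
          (by positivity)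
    _ = 3 / c ^ 4 * (3 / 2 * κ₀ * H + H ^ 2 * |s|) := by
        have hs4 : s ^ 4 = |s| ^ 4 := by
          rw [show (4:ℕ) = 2 * 2 by norm_num, pow_mul, ← sq_abs s, ← pow_mul]
        rw [hs4]
        field_simp

/-- **Tail bound for the self-strain integrand** of a near-straight curve: if `‖X′‖ ≤ 1`, `‖X′(u) − a₀‖ ≤ θ`
(`‖a₀‖ ≤ 1`), `X` is `C¹` and chord-arc from `t` (`c|u − t| ≤ ‖X u − X t‖`), then for `u ≠ t`, with `w = X t − X u`,
`T = X′ t`: `|−3⟪w, T⟫K₅(w)⟪T, X′(u) × w⟫| ≤ (6θ/c⁴)|u − t|⁻³`. [folklore] -/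
theorem selfStrain_integrand_tail_le (e : ℝ) {X : ℝ → EuclideanSpace ℝ (Fin 3)} {a₀ : EuclideanSpace ℝ (Fin 3)}
    {θ c : ℝ} (hX : ContDiff ℝ 1 X) (hdX : ∀ u, ‖deriv X u‖ ≤ 1) (ha₀ : ‖a₀‖ ≤ 1)
    (hθ : ∀ u, ‖deriv X u - a₀‖ ≤ θ) (hc : 0 < c) {t u : ℝ} (hchord : c * |u - t| ≤ ‖X u - X t‖) (hut : u ≠ t) :
    |(-3 * ⟪X t - X u, deriv X t⟫_ℝ * ((‖X t - X u‖ ^ 2 + e ^ 2) ^ (5 / 2 : ℝ))⁻¹) *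
        ⟪deriv X t, cross (deriv X u) (X t - X u)⟫_ℝ| ≤ 6 * θ / c ^ 4 * (|u - t| ^ 3)⁻¹ := by
  have hut' : 0 < |u - t| := abs_pos.2 (sub_ne_zero.2 hut)
  have hcu : 0 < c * |u - t| := mul_pos hc hut'
  have hr : c * |u - t| ≤ ‖X t - X u‖ := by rw [norm_sub_rev]; exact hchord
  have hrpos : 0 < ‖X t - X u‖ := lt_of_lt_of_le hcu hr
  obtain ⟨-, hK5⟩ := rosenhead_kernel_le_inv_pow hrpos e
  have hK5nn : 0 ≤ ((‖X t - X u‖ ^ 2 + e ^ 2) ^ (5 / 2 : ℝ))⁻¹ := inv_nonneg.2 (Real.rpow_nonneg (by positivity) _)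
  have hcross := norm_cross_chord_le_of_nearStraight hX hdX ha₀ hθ t u
  have hθ0 : 0 ≤ θ := (norm_nonneg _).trans (hθ u)
  have hinner : |⟪X t - X u, deriv X t⟫_ℝ| ≤ ‖X t - X u‖ := by
    calc |⟪X t - X u, deriv X t⟫_ℝ| ≤ ‖X t - X u‖ * ‖deriv X t‖ := abs_real_inner_le_norm _ _
      _ ≤ ‖X t - X u‖ * 1 := mul_le_mul_of_nonneg_left (hdX t) (norm_nonneg _)
      _ = ‖X t - X u‖ := mul_one _
  have hdet : |⟪deriv X t, cross (deriv X u) (X t - X u)⟫_ℝ| ≤ 2 * θ * |u - t| := by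
    calc |⟪deriv X t, cross (deriv X u) (X t - X u)⟫_ℝ| ≤ ‖deriv X t‖ * ‖cross (deriv X u) (X t - X u)‖ :=
          abs_real_inner_le_norm _ _
      _ ≤ 1 * (2 * θ * |u - t|) := mul_le_mul (hdX t) hcross (norm_nonneg _) zero_le_one
      _ = 2 * θ * |u - t| := one_mul _
  rw [abs_mul, abs_mul, abs_mul, abs_of_nonneg hK5nn, show |(-3:ℝ)| = 3 by norm_num]
  have hr4 : (c * |u - t|) ^ 4 ≤ ‖X t - X u‖ ^ 4 := pow_le_pow_left₀ hcu.le hr 4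
  calc 3 * |⟪X t - X u, deriv X t⟫_ℝ| * ((‖X t - X u‖ ^ 2 + e ^ 2) ^ (5 / 2 : ℝ))⁻¹ *
        |⟪deriv X t, cross (deriv X u) (X t - X u)⟫_ℝ|
      ≤ 3 * ‖X t - X u‖ * (‖X t - X u‖ ^ 5)⁻¹ * (2 * θ * |u - t|) := by gcongr
    _ = 6 * θ * |u - t| * (‖X t - X u‖ ^ 4)⁻¹ := by field_simp; ring
    _ ≤ 6 * θ * |u - t| * ((c * |u - t|) ^ 4)⁻¹ :=
        mul_le_mul_of_nonneg_left (inv_anti₀ (pow_pos hcu 4) hr4) (by positivity)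
    _ = 6 * θ / c ^ 4 * (|u - t| ^ 3)⁻¹ := by field_simp

/-! ### Private calculus copies (the tree's versions are private in …LiaWindowAssembly / …RungLiaReduction) -/

/-- `⟪X′(t), X″(t)⟫ = 0` along a unit-speed `C²` curve. [folklore] -/
private theorem ss_inner_eq_zero {X : ℝ → EuclideanSpace ℝ (Fin 3)} (hX : ContDiff ℝ 2 X)
    (hT1 : ∀ u, ‖deriv X u‖ = 1) (t : ℝ) : ⟪deriv X t, deriv (deriv X) t⟫_ℝ = 0 := by
  -- adapted from the private `lwa_inner_eq_zero` of …SkeletonEquilibriumLiaWindowAssembly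
  have hTd : Differentiable ℝ (deriv X) := hX.differentiable_deriv_two
  have h1 : (fun σ => ⟪deriv X σ, deriv X σ⟫_ℝ) = fun _ => (1 : ℝ) := by
    funext σ; rw [real_inner_self_eq_norm_sq, hT1 σ, one_pow]
  have h2 : HasDerivAt (fun σ => ⟪deriv X σ, deriv X σ⟫_ℝ)
      (⟪deriv X t, deriv (deriv X) t⟫_ℝ + ⟪deriv (deriv X) t, deriv X t⟫_ℝ) t :=
    (hTd t).hasDerivAt.inner ℝ (hTd t).hasDerivAt
  rw [h1] at h2
  have h3 := h2.unique (hasDerivAt_const t (1 : ℝ))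
  rw [real_inner_comm (deriv (deriv X) t)] at h3 ⊢
  linarith

/-- First-order Taylor remainder of the tangent of a `C^{2,1}` curve. [folklore] -/
private theorem ss_tangent_remainder {X : ℝ → EuclideanSpace ℝ (Fin 3)} {H : ℝ}
    (hX : ContDiff ℝ 2 X) (hH : 0 ≤ H)
    (hLip : ∀ u v, ‖deriv (deriv X) u - deriv (deriv X) v‖ ≤ H * |u - v|) (t u : ℝ) :
    ‖deriv X u - deriv X t - (u - t) • deriv (deriv X) t‖ ≤ H * (u - t) ^ 2 := by
  -- adapted from the private `lwa_tangent_remainder` of …SkeletonEquilibriumLiaWindowAssembly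
  have hTd : Differentiable ℝ (deriv X) := hX.differentiable_deriv_two
  have hφ : ∀ r, HasDerivAt (fun r => deriv X r - deriv X t - (r - t) • deriv (deriv X) t)
      (deriv (deriv X) r - deriv (deriv X) t) r := fun r => by
    have h2 : HasDerivAt (fun r : ℝ => (r - t) • deriv (deriv X) t)
        ((1 : ℝ) • deriv (deriv X) t) r := ((hasDerivAt_id' r).sub_const t).smul_const _
    rw [one_smul] at h2
    exact ((hTd r).hasDerivAt.sub_const _).sub h2
  have hbound : ∀ r ∈ Set.uIcc t u, ‖deriv (deriv X) r - deriv (deriv X) t‖ ≤ H * |u - t| :=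
    fun r hr => (hLip r t).trans (mul_le_mul_of_nonneg_left (Set.abs_sub_left_of_mem_uIcc hr) hH)
  have hmvt := (convex_uIcc t u).norm_image_sub_le_of_norm_hasDerivWithin_le
    (fun r _ => (hφ r).hasDerivWithinAt) hbound Set.left_mem_uIcc Set.right_mem_uIcc
  have h0 : deriv X t - deriv X t - (t - t) • deriv (deriv X) t = 0 := by simp
  rw [h0, sub_zero, Real.norm_eq_abs] at hmvt
  calc ‖deriv X u - deriv X t - (u - t) • deriv (deriv X) t‖ ≤ H * |u - t| * |u - t| := hmvt
    _ = H * (u - t) ^ 2 := by rw [mul_assoc, abs_mul_abs_self, pow_two]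

/-- Second-order Taylor remainder of a `C^{2,1}` curve. [folklore] -/
private theorem ss_chord_remainder {X : ℝ → EuclideanSpace ℝ (Fin 3)} {H : ℝ}
    (hX : ContDiff ℝ 2 X) (hH : 0 ≤ H)
    (hLip : ∀ u v, ‖deriv (deriv X) u - deriv (deriv X) v‖ ≤ H * |u - v|) (t u : ℝ) :
    ‖X u - X t - (u - t) • deriv X t - ((u - t) ^ 2 / 2) • deriv (deriv X) t‖ ≤
      H * |u - t| ^ 3 := by
  -- adapted from the private `lwa_chord_remainder` of …SkeletonEquilibriumLiaWindowAssembly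
  have hXd : Differentiable ℝ X := hX.differentiable (by norm_num)
  have hψ : ∀ r, HasDerivAt
      (fun r => X r - X t - (r - t) • deriv X t - ((r - t) ^ 2 / 2) • deriv (deriv X) t)
      (deriv X r - deriv X t - (r - t) • deriv (deriv X) t) r := fun r => by
    have h2 : HasDerivAt (fun r : ℝ => (r - t) • deriv X t) ((1 : ℝ) • deriv X t) r :=
      ((hasDerivAt_id' r).sub_const t).smul_const _
    rw [one_smul] at h2
    have h3 : HasDerivAt (fun r : ℝ => (r - t) ^ 2 / 2) (r - t) r := by
      refine ((((hasDerivAt_id' r).sub_const t).fun_pow 2).div_const 2).congr_deriv ?_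
      norm_num
    exact (((hXd r).hasDerivAt.sub_const _).sub h2).sub (h3.smul_const _)
  have hbound : ∀ r ∈ Set.uIcc t u,
      ‖deriv X r - deriv X t - (r - t) • deriv (deriv X) t‖ ≤ H * (u - t) ^ 2 := fun r hr => by
    refine (ss_tangent_remainder hX hH hLip t r).trans (mul_le_mul_of_nonneg_left ?_ hH)
    rw [← sq_abs (r - t), ← sq_abs (u - t)]
    exact pow_le_pow_left₀ (abs_nonneg _) (Set.abs_sub_left_of_mem_uIcc hr) 2
  have hmvt := (convex_uIcc t u).norm_image_sub_le_of_norm_hasDerivWithin_le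
    (fun r _ => (hψ r).hasDerivWithinAt) hbound Set.left_mem_uIcc Set.right_mem_uIcc
  have h0 : X t - X t - (t - t) • deriv X t - ((t - t) ^ 2 / 2) • deriv (deriv X) t = 0 := by simp
  rw [h0, sub_zero, Real.norm_eq_abs] at hmvt
  calc ‖X u - X t - (u - t) • deriv X t - ((u - t) ^ 2 / 2) • deriv (deriv X) t‖
      ≤ H * (u - t) ^ 2 * |u - t| := hmvt
    _ = H * |u - t| ^ 3 := by rw [← sq_abs]; ring

/-- The inverse-cube majorant on the translated symmetric tail: for `0 < δ` and a constant `C`,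
`u ↦ C (|u − t|³)⁻¹` is integrable on `{u | δ ≤ |u − t|}` with integral `C/δ²`. [folklore] -/
private theorem ss_majorant_tail (C t : ℝ) {δ : ℝ} (hδ : 0 < δ) :
    IntegrableOn (fun u : ℝ => C * (|u - t| ^ 3)⁻¹) {u : ℝ | δ ≤ |u - t|} ∧
      ∫ u in {u : ℝ | δ ≤ |u - t|}, C * (|u - t| ^ 3)⁻¹ = C / δ ^ 2 := by
  -- adapted from `nst_majorant_tail` of …RungNearStraightTail (inverse square there)
  have hIoi : ∫ v in Ioi δ, (|v| ^ 3)⁻¹ = δ⁻¹ ^ 2 / 2 := by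
    calc ∫ v in Ioi δ, (|v| ^ 3)⁻¹ = ∫ v in Ioi δ, v ^ (-3 : ℝ) := by
          refine setIntegral_congr_fun measurableSet_Ioi fun v hv => ?_
          have hv0 : 0 < v := hδ.trans hv
          rw [abs_of_pos hv0, Real.rpow_neg hv0.le, show (3:ℝ) = ((3:ℕ):ℝ) by norm_num, Real.rpow_natCast]
      _ = δ⁻¹ ^ 2 / 2 := by
          rw [integral_Ioi_rpow_of_lt (by norm_num) hδ, show (-3 : ℝ) + 1 = -2 by norm_num,
            Real.rpow_neg hδ.le, show (2:ℝ) = ((2:ℕ):ℝ) by norm_num, Real.rpow_natCast, inv_pow]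
          ring
  have hIic : ∫ v in Iic (-δ), (|v| ^ 3)⁻¹ = δ⁻¹ ^ 2 / 2 := by
    have h := integral_comp_neg_Iic (-δ) (fun v : ℝ => (|v| ^ 3)⁻¹)
    simp only [abs_neg, neg_neg] at h
    rw [h, hIoi]
  have hIci : ∫ v in Ici δ, (|v| ^ 3)⁻¹ = δ⁻¹ ^ 2 / 2 := by
    rw [integral_Ici_eq_integral_Ioi, hIoi]
  have hne : (δ⁻¹ ^ 2 / 2 : ℝ) ≠ 0 := by positivity
  have hint1 : IntegrableOn (fun v : ℝ => (|v| ^ 3)⁻¹) (Iic (-δ)) :=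
    Integrable.of_integral_ne_zero (by rw [hIic]; exact hne)
  have hint2 : IntegrableOn (fun v : ℝ => (|v| ^ 3)⁻¹) (Ici δ) :=
    Integrable.of_integral_ne_zero (by rw [hIci]; exact hne)
  have hdisj : Disjoint (Iic (-δ)) (Ici δ) :=
    Set.disjoint_left.2 fun v hv1 hv2 => by
      simp only [mem_Iic, mem_Ici] at hv1 hv2
      linarith
  have htail : {v : ℝ | δ ≤ |v|} = Iic (-δ) ∪ Ici δ := by
    ext v
    simp only [mem_setOf_eq, mem_union, mem_Iic, mem_Ici, le_abs']
  have hint0 : IntegrableOn (fun v : ℝ => (|v| ^ 3)⁻¹) {v : ℝ | δ ≤ |v|} := by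
    rw [htail]; exact hint1.union hint2
  have hval0 : ∫ v in {v : ℝ | δ ≤ |v|}, (|v| ^ 3)⁻¹ = δ⁻¹ ^ 2 := by
    rw [htail, setIntegral_union hdisj measurableSet_Ici hint1 hint2, hIic, hIci]
    ring
  have hmp : MeasurePreserving (fun u : ℝ => u - t) volume volume := measurePreserving_sub_right volume t
  have hme : MeasurableEmbedding (fun u : ℝ => u - t) := measurableEmbedding_subRight t
  have hint' : IntegrableOn (fun u : ℝ => (|u - t| ^ 3)⁻¹) {u : ℝ | δ ≤ |u - t|} :=
    (hmp.integrableOn_comp_preimage hme).2 hint0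
  have hval' : ∫ u in {u : ℝ | δ ≤ |u - t|}, (|u - t| ^ 3)⁻¹ = δ⁻¹ ^ 2 := by
    rw [← hval0]
    exact hmp.setIntegral_preimage_emb hme (fun v : ℝ => (|v| ^ 3)⁻¹) {v : ℝ | δ ≤ |v|}
  refine ⟨hint'.const_mul _, ?_⟩
  rw [integral_const_mul, hval', inv_pow, div_eq_mul_inv]

/-! ### Assembly -/

/-- **The axial self-strain of a near-straight `C^{2,1}` filament is small.**  Let `X` be `C²` with `‖X′‖ ≡ 1`,
`‖X″‖ ≤ κ₀`, `X″` `H`-Lipschitz, linear growth from the origin (`c₀|u| − C ≤ ‖X u‖`, for differentiability of the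
field), chord-arc from `t` with constant `c > 0`, and near-straight (`‖X′(u) − a₀‖ ≤ θ`, `‖a₀‖ ≤ 1`); let
`F(y) = ∫ K₃(y − X u) • X′(u) × (y − X u) du` be its regularised Biot–Savart field (core `e ≠ 0`).  Then for every
window `δ > 0`:
`|⟪X′ t, (fderiv F (X t)) (X′ t)⟫| ≤ 6θ/(c⁴δ²) + 2δ · (3/c⁴)((3/2)κ₀H + H²δ)`. [folklore] -/
theorem self_axialStrain_le {e c₀ C c H κ₀ δ θ : ℝ} {X : ℝ → EuclideanSpace ℝ (Fin 3)}
    {a₀ : EuclideanSpace ℝ (Fin 3)} (he : e ≠ 0) (hc₀ : 0 < c₀) (hgrow : ∀ u, c₀ * |u| - C ≤ ‖X u‖)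
    (hX : ContDiff ℝ 2 X) (hT1 : ∀ u, ‖deriv X u‖ = 1) (hκ₀ : ∀ u, ‖deriv (deriv X) u‖ ≤ κ₀)
    (hH : 0 ≤ H) (hLip : ∀ u v, ‖deriv (deriv X) u - deriv (deriv X) v‖ ≤ H * |u - v|)
    {t : ℝ} (hc : 0 < c) (hchord : ∀ u, c * |u - t| ≤ ‖X u - X t‖) (hδ : 0 < δ)
    (ha₀ : ‖a₀‖ ≤ 1) (hθ : ∀ u, ‖deriv X u - a₀‖ ≤ θ) :
    |⟪deriv X t, fderiv ℝ (fun y : EuclideanSpace ℝ (Fin 3) => ∫ u : ℝ,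
        ((‖y - X u‖ ^ 2 + e ^ 2) ^ (3 / 2 : ℝ))⁻¹ • cross (deriv X u) (y - X u)) (X t) (deriv X t)⟫_ℝ| ≤
      6 * θ / (c ^ 4 * δ ^ 2) + 2 * δ * (3 / c ^ 4 * (3 / 2 * κ₀ * H + H ^ 2 * δ)) := by
  have hX1 : ContDiff ℝ 1 X := hX.of_le (by norm_num)
  have hdX : ∀ u, ‖deriv X u‖ ≤ 1 := fun u => (hT1 u).le
  have hκ : 0 ≤ κ₀ := (norm_nonneg _).trans (hκ₀ t)
  have hθ0 : 0 ≤ θ := (norm_nonneg _).trans (hθ t)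
  set T := deriv X t with hTdef
  set y := X t with hydef
  -- the derivative integrand and its scalar pairing with `T`
  set G : ℝ → EuclideanSpace ℝ (Fin 3) := fun u =>
    (-3 * ⟪y - X u, T⟫_ℝ * ((‖y - X u‖ ^ 2 + e ^ 2) ^ (5 / 2 : ℝ))⁻¹) • cross (deriv X u) (y - X u)
      + ((‖y - X u‖ ^ 2 + e ^ 2) ^ (3 / 2 : ℝ))⁻¹ • cross (deriv X u) T with hG
  have hGint : Integrable G := (stub_biotSavartDirectionalDeriv e c₀ C X he hc₀ hX1 hdX hgrow y T).1
  have happ := biotSavart_fderiv_apply_eq he hc₀ hX1 hdX hgrow y T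
  rw [happ, ← integral_inner hGint T]
  -- the scalar integrand
  set φ : ℝ → ℝ := fun u => ⟪T, G u⟫_ℝ with hφ
  have hTxT : ∀ x : EuclideanSpace ℝ (Fin 3), ⟪T, cross x T⟫_ℝ = 0 := fun x => by
    simp [cross, crossProduct, PiLp.inner_apply, Fin.sum_univ_three]; ring
  have hφeq : ∀ u, φ u = (-3 * ⟪y - X u, T⟫_ℝ * ((‖y - X u‖ ^ 2 + e ^ 2) ^ (5 / 2 : ℝ))⁻¹) *
      ⟪T, cross (deriv X u) (y - X u)⟫_ℝ := by
    intro u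
    simp only [hφ, hG, inner_add_right, real_inner_smul_right, hTxT, mul_zero, add_zero]
  have hφint : Integrable φ := hGint.const_inner T
  -- window bound
  set W : ℝ := 3 / c ^ 4 * (3 / 2 * κ₀ * H + H ^ 2 * δ) with hWdef
  have hW0 : 0 ≤ W := by rw [hWdef]; positivity
  have hwin_pt : ∀ u, |u - t| ≤ δ → |φ u| ≤ W := by
    intro u hu
    rw [hφeq u]
    have h := selfStrain_integrand_window_le e (T := T) (N := deriv (deriv X) t) (a := deriv X u)
      (z := X u - X t) (w := y - X u) (s := u - t) (hT1 t) (hκ₀ t) hH hc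
      (ss_tangent_remainder hX hH hLip t u) (ss_chord_remainder hX hH hLip t u) (hchord u)
      (by rw [hydef]; abel)
    refine h.trans ?_
    rw [hWdef]
    gcongr
  -- tail bound
  have htail_pt : ∀ u ∈ {u : ℝ | δ ≤ |u - t|}, ‖φ u‖ ≤ 6 * θ / c ^ 4 * (|u - t| ^ 3)⁻¹ := by
    intro u hu
    simp only [mem_setOf_eq] at hu
    have hut : u ≠ t := by
      intro h; rw [h, sub_self, abs_zero] at hu; linarith
    rw [Real.norm_eq_abs, hφeq u]
    exact selfStrain_integrand_tail_le e hX1 hdX ha₀ hθ hc (hchord u) hut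
  -- split the line into tail and window
  have hSm : MeasurableSet {u : ℝ | δ ≤ |u - t|} :=
    (isClosed_le continuous_const (continuous_abs.comp (continuous_id.sub continuous_const))).measurableSet
  have hSc : {u : ℝ | δ ≤ |u - t|}ᶜ = Set.Ioo (t - δ) (t + δ) := by
    ext u
    simp only [Set.mem_compl_iff, Set.mem_setOf_eq, not_le, Set.mem_Ioo, abs_sub_lt_iff]
    constructor <;> rintro ⟨h1, h2⟩ <;> constructor <;> linarith
  obtain ⟨hg_int, hg_val⟩ := ss_majorant_tail (6 * θ / c ^ 4) t hδ
  have htailB : ‖∫ u in {u : ℝ | δ ≤ |u - t|}, φ u‖ ≤ 6 * θ / c ^ 4 / δ ^ 2 := by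
    calc ‖∫ u in {u : ℝ | δ ≤ |u - t|}, φ u‖ ≤ ∫ u in {u : ℝ | δ ≤ |u - t|}, 6 * θ / c ^ 4 * (|u - t| ^ 3)⁻¹ :=
          norm_integral_le_of_norm_le hg_int ((ae_restrict_iff' hSm).2 (Eventually.of_forall htail_pt))
      _ = 6 * θ / c ^ 4 / δ ^ 2 := hg_val
  have hwinB : ‖∫ u in {u : ℝ | δ ≤ |u - t|}ᶜ, φ u‖ ≤ W * (2 * δ) := by
    rw [hSc, ← integral_Ioc_eq_integral_Ioo, ← intervalIntegral.integral_of_le (show t - δ ≤ t + δ by linarith)]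
    have h := intervalIntegral.norm_integral_le_of_norm_le_const (a := t - δ) (b := t + δ) (C := W) (f := φ)
      (fun u hu => by
        rw [Set.uIoc_of_le (by linarith : t - δ ≤ t + δ)] at hu
        rw [Real.norm_eq_abs]
        exact hwin_pt u (abs_le.2 ⟨by linarith [hu.1], by linarith [hu.2]⟩))
    rwa [show t + δ - (t - δ) = 2 * δ by ring, abs_of_pos (by positivity : (0 : ℝ) < 2 * δ)] at h
  rw [← integral_add_compl hSm hφint]
  have := norm_add_le (∫ u in {u : ℝ | δ ≤ |u - t|}, φ u) (∫ u in {u : ℝ | δ ≤ |u - t|}ᶜ, φ u)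
  rw [Real.norm_eq_abs] at this
  calc |(∫ u in {u : ℝ | δ ≤ |u - t|}, φ u) + ∫ u in {u : ℝ | δ ≤ |u - t|}ᶜ, φ u|
      ≤ 6 * θ / c ^ 4 / δ ^ 2 + W * (2 * δ) := this.trans (add_le_add htailB hwinB)
    _ = 6 * θ / (c ^ 4 * δ ^ 2) + 2 * δ * (3 / c ^ 4 * (3 / 2 * κ₀ * H + H ^ 2 * δ)) := by
        rw [hWdef, div_div]; ring

end SelectionBoxRJRung

end Summit.NavierStokesRegularity.NavierStokesRegularity.Theorems
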